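import Summits.QuantumFields.BalabanUV.T4Continuum.Support.NE7GradientCurrencyLandauEL
import HarnessLib

/-!
# NE7LandauLaplacianLetter — THE (10)-TYPE LETTER OF A LANDAU REPRESENTATIVE FROM ITS SUP AND GRADIENT CURRENCIES: for `W = e^{A}` with `‖A‖ ≤ ρ`, a priori
# gradient bound `G`, plaquette-divergence datum `J` and reaction-gradient `P`, the FLAT LATTICE LAPLACIAN of every component obeys
# `‖Δ A_ν‖ ≤ J + 4d(e^{4ρ} − 1)·G + P`; docked to a gauge field `U` (`U^{u₀} = e^{A₀}`, `SmallField U ε`, `‖covDiv 1 U‖ ≤ j`) with the reaction in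
# Euler–Lagrange form: `‖Δ A₀,ν‖ ≤ j + dε((e^{2a₀}−1) + 2ε(2+ε)) + (4d(e^{4a₀}−1) + 2d(e^{a₀}−1))·G + r` — LOG-FREE: only the CURRENT `j` enters, not `∇F`
# (file F5 of gen 112's line «flat interior C^{1,log-Lip} potential theory + (10) ⟹ (9)_{β<1}»)

Cell `pub-balaban`, rung (B)+1 sub-cell t4, lineage `b2b-balaban-t4-ne7-p1` (CRUX PROVER NE7 #1 = OWNER of BINDER row NE7), generation 112.  Memo
`t4/b2b-balaban-t4-ne7-p1-g112/ROAD-G112.md` §3.  Over the co-owner lineage's chain (156)–(158b) (`NE7LatticeHodgeGradient.laplacian_eq_sum_dCurl_add_dDiv`,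
`NE7GradientCurrency.norm_plaqRem_sub_plaqRem_le`∕`hol_vary_flat_plaqWord`, `NE7GradientCurrencyCovariant.norm_plaqDivFlat_le_covDiv_gaugeAct`,
`NE7GradientCurrencyLandauEL.norm_dDiv_sub_dDiv_sinh_le`), which bound the GRADIENT of `A` from these data; THIS file reads the same data on the LAPLACIAN.
WHY (row NE7, [Balaban1985Variational] Thm 1 (10), `|Δ^ηA| ≲ ε`).  The componentwise flat Laplacian of a bond field is `δ(dA) + d(δA)` EXACTLY ((156) §1).  For a
representative `W = e^{A}`: `dA = (W(∂p) − 1) − plaqRem`, so `δ(dA)` is the flat plaquette divergence (gauge-comparable to the COVARIANT CURRENT `covDiv 1 U`, (158) §1,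
at second-order cost) minus differences of the plaquette remainder (`4d(e^{4ρ}−1)·G`, (157) §1); and `d(δA)` is the reaction gradient of `div A`, which in a
lattice Landau gauge (`div sinh A =` reaction, (161b)) is the Euler–Lagrange reaction gradient `r` plus `2d(e^ρ−1)·G` ((158b) §1).  CONSEQUENCE: the (10)-type
letter needs the CURRENT (row NE7's ✓ p814818: `‖covDiv 1 U‖ ≤ Cε∕M³`, k-uniform, log-free) and the gradient currency `G` (✓ (162)
`gradient_currency_latticeLandau` from `(a₀, j)` on a torus), NOT the covariant flux gradient `∇_U F` (which carries the junction logarithm, ROAD-G110 §4).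
WHAT ([folklore]; 0 def, 0 sorry; every `d`, `U(n) ⊂ M_n(ℂ)`).  §1 `norm_curlDiv_le_of_plaqDiv` ((157)'s internal step, exported: `‖δ(dA)_ν‖ ≤ J + 4d(e^{4ρ}−1)G`),
**`norm_laplacian_le_of_plaqDiv`** (`‖ΔA_ν‖ ≤ J + 4d(e^{4ρ}−1)G + P`).  §2 **`norm_laplacian_le_of_covDiv_EL`** (docked: `U`, `u₀`, `A₀`, `ε`, `j`, `a₀`, `G`, `r`).
HONEST FRAMING (page 1): elementary lattice∕Banach-algebra bookkeeping at ONE configuration; the sup currency `a₀`, the gradient currency `G`, the current `j` and the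
reaction `r` are HYPOTHESES; nothing of Bałaban's asserted; nothing about minimisers; NOT NE3∕NE7 as spine nodes; spine 0∕9; finite T⁴ rung (B)+1 — NOT infinite
volume, NOT mass gap, NOT BetaPertH, NOT Clay (continuum YM on T⁴ ⇐ BetaPertH ∧ nine spine estimates).
-/

set_option autoImplicit false

open NormedSpace
open scoped BigOperators Matrix.Norms.L2Operator
open Finset

namespace Summit.QuantumFields.BalabanUV.T4Continuum.NE7LandauLaplacianLetter

open Literature.MathematicalPhysics.QuantumFieldTheory.Balaban1983to89
open B7Prop1Explicit B7Prop2Explicit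
open B8Ineq132 (covDiv)
open T4AveragingDeficitWall (vary SmallField)
open BlockAveragePushDirSplit (flat)
open NE7LatticeHodgeGradient (laplacian_eq_sum_dCurl_add_dDiv)
open NE7GradientCurrency (norm_plaqRem_sub_plaqRem_le hol_vary_flat_plaqWord)
open NE7GradientCurrencyCovariant (norm_plaqDivFlat_le_covDiv_gaugeAct)
open NE7GradientCurrencyLandauEL (norm_dDiv_sub_dDiv_sinh_le)

noncomputable section

variable {d : ℕ} {n : Type*} [Fintype n] [DecidableEq n] [Nonempty n]

/-! ## §1 The Laplacian of a representative `W = e^{A}` from the plaquette divergence, the remainder and the reaction gradient -/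

/-- **THE CO-DIFFERENTIAL OF THE LINEAR CURL FROM THE PLAQUETTE DIVERGENCE** ((157)'s internal step, exported): for `A` with `‖A‖ ≤ ρ`, an a priori bound `G`
on all forward differences and `J` a bound on the flat lattice co-differential `Σ_μ [(W(∂p_{μν}(y)) − 1) − (W(∂p_{μν}(y−e_μ)) − 1)]` of the plaquette deviation of
`W = e^{A}`: `‖Σ_μ [dA(y;μ,ν) − dA(y−e_μ;μ,ν)]‖ ≤ J + 4d(e^{4ρ} − 1)·G`. [folklore] -/
theorem norm_curlDiv_le_of_plaqDiv (A : Site d → Fin d → (Matrix n n ℂ)) {ρ G J : ℝ}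
    (hA : ∀ (x : Site d) (κ : Fin d), ‖A x κ‖ ≤ ρ)
    (hG : ∀ (x : Site d) (κ τ : Fin d), ‖A (x + e τ) κ - A x κ‖ ≤ G)
    (hJ : ∀ (x : Site d) (ν : Fin d),
      ‖∑ μ, ((((hol (vary (flat (d := d) (n := n)) A 1) x (plaqWord μ ν) : (Matrix n n ℂ)ˣ) : (Matrix n n ℂ)) - 1)
              - (((hol (vary (flat (d := d) (n := n)) A 1) (x - e μ) (plaqWord μ ν) : (Matrix n n ℂ)ˣ) : (Matrix n n ℂ)) - 1))‖ ≤ J)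
    (y : Site d) (ν : Fin d) :
    ‖∑ μ, ((A y μ + A (y + e μ) ν - A (y + e ν) μ - A y ν)
            - (A (y - e μ) μ + A (y - e μ + e μ) ν - A (y - e μ + e ν) μ - A (y - e μ) ν))‖
      ≤ J + 4 * d * (Real.exp (4 * ρ) - 1) * G := by
  set W := vary (flat (d := d) (n := n)) A 1 with hW
  have hrem : ∀ (z : Site d) (μ : Fin d),
      (A z μ + A (z + e μ) ν - A (z + e ν) μ - A z ν)
        = (((hol W z (plaqWord μ ν) : (Matrix n n ℂ)ˣ) : (Matrix n n ℂ)) - 1)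
          - (exp (A z μ) * exp (A (z + e μ) ν) * exp (-A (z + e ν) μ) * exp (-A z ν) - 1
              - (A z μ + A (z + e μ) ν + -A (z + e ν) μ + -A z ν)) := by
    intro z μ
    rw [hW, hol_vary_flat_plaqWord]
    abel
  have hG0 : 0 ≤ G := (norm_nonneg _).trans (hG y ν ν)
  have hdiff : ∀ μ : Fin d,
      ‖(exp (A y μ) * exp (A (y + e μ) ν) * exp (-A (y + e ν) μ) * exp (-A y ν) - 1
            - (A y μ + A (y + e μ) ν + -A (y + e ν) μ + -A y ν))
        - (exp (A (y - e μ) μ) * exp (A (y - e μ + e μ) ν) * exp (-A (y - e μ + e ν) μ) * exp (-A (y - e μ) ν) - 1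
            - (A (y - e μ) μ + A (y - e μ + e μ) ν + -A (y - e μ + e ν) μ + -A (y - e μ) ν))‖
        ≤ (Real.exp (4 * ρ) - 1) * (4 * G) := by
    intro μ
    have h := norm_plaqRem_sub_plaqRem_le (hA y μ) (hA (y + e μ) ν) (by rw [norm_neg]; exact hA (y + e ν) μ)
      (by rw [norm_neg]; exact hA y ν) (hA (y - e μ) μ) (hA (y - e μ + e μ) ν)
      (by rw [norm_neg]; exact hA (y - e μ + e ν) μ) (by rw [norm_neg]; exact hA (y - e μ) ν)
    refine h.trans (mul_le_mul_of_nonneg_left ?_ ?_)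
    · have h1 : ‖A y μ - A (y - e μ) μ‖ ≤ G := by
        have := hG (y - e μ) μ μ; rwa [sub_add_cancel] at this
      have h2 : ‖A (y + e μ) ν - A (y - e μ + e μ) ν‖ ≤ G := by
        have := hG (y - e μ + e μ) ν μ
        simp only [sub_add_cancel] at this ⊢
        exact this
      have h3 : ‖-A (y + e ν) μ - -A (y - e μ + e ν) μ‖ ≤ G := by
        have := hG (y - e μ + e ν) μ μ
        rw [show y - e μ + e ν + e μ = y + e ν by abel] at this
        rw [show -A (y + e ν) μ - -A (y - e μ + e ν) μ = -(A (y + e ν) μ - A (y - e μ + e ν) μ) by abel, norm_neg]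
        exact this
      have h4 : ‖-A y ν - -A (y - e μ) ν‖ ≤ G := by
        have := hG (y - e μ) ν μ
        rw [sub_add_cancel] at this
        rw [show -A y ν - -A (y - e μ) ν = -(A y ν - A (y - e μ) ν) by abel, norm_neg]
        exact this
      linarith
    · have hρ0 : 0 ≤ ρ := (norm_nonneg _).trans (hA y ν)
      have := Real.one_le_exp (by positivity : 0 ≤ 4 * ρ)
      linarith
  have hsplit : ∑ μ, ((A y μ + A (y + e μ) ν - A (y + e ν) μ - A y ν)
        - (A (y - e μ) μ + A (y - e μ + e μ) ν - A (y - e μ + e ν) μ - A (y - e μ) ν))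
      = ∑ μ, ((((hol W y (plaqWord μ ν) : (Matrix n n ℂ)ˣ) : (Matrix n n ℂ)) - 1) - (((hol W (y - e μ) (plaqWord μ ν) : (Matrix n n ℂ)ˣ) : (Matrix n n ℂ)) - 1))
        - ∑ μ, ((exp (A y μ) * exp (A (y + e μ) ν) * exp (-A (y + e ν) μ) * exp (-A y ν) - 1
            - (A y μ + A (y + e μ) ν + -A (y + e ν) μ + -A y ν))
          - (exp (A (y - e μ) μ) * exp (A (y - e μ + e μ) ν) * exp (-A (y - e μ + e ν) μ) * exp (-A (y - e μ) ν) - 1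
            - (A (y - e μ) μ + A (y - e μ + e μ) ν + -A (y - e μ + e ν) μ + -A (y - e μ) ν))) := by
    rw [← Finset.sum_sub_distrib]
    refine Finset.sum_congr rfl fun μ _ => ?_
    rw [hrem y μ, hrem (y - e μ) μ]
    abel
  rw [hsplit]
  refine (norm_sub_le _ _).trans ?_
  have hsum : ‖∑ μ : Fin d, ((exp (A y μ) * exp (A (y + e μ) ν) * exp (-A (y + e ν) μ) * exp (-A y ν) - 1
            - (A y μ + A (y + e μ) ν + -A (y + e ν) μ + -A y ν))
          - (exp (A (y - e μ) μ) * exp (A (y - e μ + e μ) ν) * exp (-A (y - e μ + e ν) μ) * exp (-A (y - e μ) ν) - 1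
            - (A (y - e μ) μ + A (y - e μ + e μ) ν + -A (y - e μ + e ν) μ + -A (y - e μ) ν)))‖
      ≤ 4 * d * (Real.exp (4 * ρ) - 1) * G := by
    refine (norm_sum_le _ _).trans ?_
    calc _ ≤ ∑ _μ : Fin d, (Real.exp (4 * ρ) - 1) * (4 * G) := Finset.sum_le_sum fun μ _ => hdiff μ
      _ = 4 * d * (Real.exp (4 * ρ) - 1) * G := by
          rw [Finset.sum_const, Finset.card_univ, Fintype.card_fin, nsmul_eq_mul]; ring
  exact add_le_add (hJ y ν) hsum

/-- **THE LAPLACIAN OF A REPRESENTATIVE FROM PLAQUETTE DIVERGENCE, REMAINDER AND REACTION GRADIENT**: for `A` with `‖A‖ ≤ ρ`, a priori gradient bound `G`,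
plaquette-divergence datum `J` (as above) and `P` a bound on the forward differences of `div A`: the componentwise flat lattice Laplacian
`Σ_i [(A(y+e_i)_ν − A(y)_ν) − (A(y)_ν − A(y−e_i)_ν)]` obeys `‖Δ A_ν(y)‖ ≤ J + 4d(e^{4ρ} − 1)·G + P` ((156) §1: `ΔA_ν = δ(dA)_ν + d(δA)_ν`). [folklore] -/
theorem norm_laplacian_le_of_plaqDiv (A : Site d → Fin d → (Matrix n n ℂ)) {ρ G J P : ℝ}
    (hA : ∀ (x : Site d) (κ : Fin d), ‖A x κ‖ ≤ ρ)
    (hG : ∀ (x : Site d) (κ τ : Fin d), ‖A (x + e τ) κ - A x κ‖ ≤ G)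
    (hJ : ∀ (x : Site d) (ν : Fin d),
      ‖∑ μ, ((((hol (vary (flat (d := d) (n := n)) A 1) x (plaqWord μ ν) : (Matrix n n ℂ)ˣ) : (Matrix n n ℂ)) - 1)
              - (((hol (vary (flat (d := d) (n := n)) A 1) (x - e μ) (plaqWord μ ν) : (Matrix n n ℂ)ˣ) : (Matrix n n ℂ)) - 1))‖ ≤ J)
    (hP : ∀ (x : Site d) (ν : Fin d), ‖∑ μ, (A (x + e ν) μ - A (x + e ν - e μ) μ) - ∑ μ, (A x μ - A (x - e μ) μ)‖ ≤ P)
    (y : Site d) (ν : Fin d) :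
    ‖∑ i, ((A (y + e i) ν - A y ν) - (A y ν - A (y - e i) ν))‖ ≤ J + 4 * d * (Real.exp (4 * ρ) - 1) * G + P := by
  rw [laplacian_eq_sum_dCurl_add_dDiv A y ν]
  exact (norm_add_le _ _).trans (add_le_add (norm_curlDiv_le_of_plaqDiv A hA hG hJ y ν) (hP y ν))

/-! ## §2 Docked: a gauge field `U`, a unitary gauge `u₀` with `U^{u₀} = e^{A₀}`, the covariant current and the reaction in Euler–Lagrange form -/

/-- **THE (10)-TYPE LETTER OF A LANDAU REPRESENTATIVE, DOCKED.**  For a configuration `U` with `SmallField U ε` and covariant flux divergence `‖covDiv 1 U ν x‖ ≤ j`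
([Balaban1985RegularSpaces] (1.2)∕(1.9) TYPE), a unitary gauge `u₀` and `A₀` with `U^{u₀} = e^{A₀}` (`gaugeAct u₀ U = vary flat A₀ 1`), sup currency `‖A₀‖ ≤ a₀`,
a priori gradient currency `‖A₀(x+e_τ)_κ − A₀(x)_κ‖ ≤ G`, and a bound `r` on the forward differences of the Euler–Lagrange reaction
`Σ_μ [sinh A₀(x)_μ − sinh A₀(x−e_μ)_μ]` (it VANISHES in an exact lattice Landau gauge, (161b)): at every site and component,
`‖Σ_i [(A₀(y+e_i)_ν − A₀(y)_ν) − (A₀(y)_ν − A₀(y−e_i)_ν)]‖ ≤ (j + dε((e^{2a₀} − 1) + 2ε(2 + ε))) + 4d(e^{4a₀} − 1)·G + (2d(e^{a₀} − 1)·G + r)`.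
NO flux-gradient bound enters: the Laplacian sees the CURRENT. [folklore] -/
theorem norm_laplacian_le_of_covDiv_EL {U : Site d → Fin d → (Matrix n n ℂ)ˣ} {ε j : ℝ} (hε0 : 0 ≤ ε) (hUε : SmallField U ε)
    (hcov : ∀ (ν : Fin d) (x : Site d), ‖covDiv 1 U ν x‖ ≤ j)
    {u₀ : Site d → (Matrix n n ℂ)ˣ} (hu₀ : ∀ y : Site d, u₀ y ∈ unitaryUnits (Matrix n n ℂ)) {A₀ : Site d → Fin d → (Matrix n n ℂ)}
    (hgauge₀ : gaugeAct u₀ U = vary (flat (d := d) (n := n)) A₀ 1)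
    {a₀ G r : ℝ} (ha₀ : ∀ (y : Site d) (κ : Fin d), ‖A₀ y κ‖ ≤ a₀)
    (hG : ∀ (x : Site d) (κ τ : Fin d), ‖A₀ (x + e τ) κ - A₀ x κ‖ ≤ G)
    (hEL : ∀ (x : Site d) (ν : Fin d),
      ‖∑ μ, (((2 : ℂ)⁻¹ • (exp (A₀ (x + e ν) μ) - exp (-A₀ (x + e ν) μ)))
                - ((2 : ℂ)⁻¹ • (exp (A₀ (x + e ν - e μ) μ) - exp (-A₀ (x + e ν - e μ) μ))))
          - ∑ μ, (((2 : ℂ)⁻¹ • (exp (A₀ x μ) - exp (-A₀ x μ))) - ((2 : ℂ)⁻¹ • (exp (A₀ (x - e μ) μ) - exp (-A₀ (x - e μ) μ))))‖ ≤ r)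
    (y : Site d) (ν : Fin d) :
    ‖∑ i, ((A₀ (y + e i) ν - A₀ y ν) - (A₀ y ν - A₀ (y - e i) ν))‖
      ≤ (j + d * (ε * ((Real.exp (2 * a₀) - 1) + 2 * ε * (2 + ε)))) + 4 * d * (Real.exp (4 * a₀) - 1) * G
        + (2 * d * (Real.exp a₀ - 1) * G + r) := by
  refine norm_laplacian_le_of_plaqDiv A₀ ha₀ hG
    (fun x μ => (norm_plaqDivFlat_le_covDiv_gaugeAct hε0 hUε hu₀ hgauge₀ ha₀ x μ).trans (add_le_add (hcov μ x) le_rfl)) (fun x μ => ?_) y ν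
  -- the reaction gradient of `div A₀` from that of `div sinh A₀`
  have h1 := norm_dDiv_sub_dDiv_sinh_le A₀ ha₀ hG x μ
  have h2 := hEL x μ
  calc _ ≤ ‖(∑ κ, (A₀ (x + e μ) κ - A₀ (x + e μ - e κ) κ) - ∑ κ, (A₀ x κ - A₀ (x - e κ) κ))
        - (∑ κ, (((2 : ℂ)⁻¹ • (exp (A₀ (x + e μ) κ) - exp (-A₀ (x + e μ) κ)))
                - ((2 : ℂ)⁻¹ • (exp (A₀ (x + e μ - e κ) κ) - exp (-A₀ (x + e μ - e κ) κ))))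
          - ∑ κ, (((2 : ℂ)⁻¹ • (exp (A₀ x κ) - exp (-A₀ x κ))) - ((2 : ℂ)⁻¹ • (exp (A₀ (x - e κ) κ) - exp (-A₀ (x - e κ) κ)))))‖
        + ‖∑ κ, (((2 : ℂ)⁻¹ • (exp (A₀ (x + e μ) κ) - exp (-A₀ (x + e μ) κ)))
                - ((2 : ℂ)⁻¹ • (exp (A₀ (x + e μ - e κ) κ) - exp (-A₀ (x + e μ - e κ) κ))))
          - ∑ κ, (((2 : ℂ)⁻¹ • (exp (A₀ x κ) - exp (-A₀ x κ))) - ((2 : ℂ)⁻¹ • (exp (A₀ (x - e κ) κ) - exp (-A₀ (x - e κ) κ))))‖ :=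
        norm_le_norm_sub_add _ _
    _ ≤ 2 * d * (Real.exp a₀ - 1) * G + r := add_le_add h1 h2

end

end Summit.QuantumFields.BalabanUV.T4Continuum.NE7LandauLaplacianLetter
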